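import Mathlib
import Summits.AtomisticToContinuum.HydrodynamicLimit.Theorems.InformationPercolationEngineKickFairRelEquilibriumMesoDefs
import HarnessLib

/-!
# `KickFairRelEquilibriumMeso`, line `Sketch` — glue T, part (c3): level sets of the time-zero key

Helper file (`--supports stmt-AtomisticToContinuum-15177`) of the line lead for the registered glue stub
`stub_pinchTransfer`: elementary facts about the level sets `{z | cellKey r w z = β}` of the binned
time-zero cell data.

* `measurableSet_cellKey_eq` — level sets are measurable (each per-cell component is a measurable
  function of the configuration: counts, floors of linear maps); `keyLevel` — the level set through a configuration;
* `abs_kinEnergy_sub_le_of_cellKey_eq` — two configurations with the same key have kinetic energies within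
  `(N+1) · w` of each other (same occupied cells, at most `N+1` of them, binned cell energies agree to width `w`);
* `kinEnergy_le_of_cellKey_eq` — hence a level set met by a configuration of energy `≤ K(N+1)` lies inside
  `{KE ≤ (K + w)(N+1)}`.
-/

noncomputable section

open MeasureTheory Set Filter Topology
open scoped ENNReal Classical

namespace Summit.AtomisticToContinuum.HydrodynamicLimit.Theorems.KickFairRelEquilibriumMesoLine

open Literature.Analysis.FluidPDE Literature.MathematicalPhysics.KineticTheory

variable {N : ℕ}

/-! ## The per-cell data as measurable functions -/

/-- The cell map of a particle is measurable in the configuration. [folklore] -/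
theorem measurable_coarseCell_apply (r : ℝ) (i : Fin (N + 1)) :
    Measurable (fun z : Phase N => Torus.coarseCell r (z i).1) :=
  (Torus.measurable_coarseCell r).comp ((measurable_pi_apply i).fst)

/-- The set of particles in cell `k` is `{i | Torus.coarseCell r (z i).1 = k}`; its count as a real number is a finite sum
of indicators. [folklore] -/
theorem card_filter_cellOf_eq (r : ℝ) (z : Phase N) (k : Fin 3 → ℤ) :
    ((Finset.univ.filter fun i => Torus.coarseCell r (z i).1 = k).card : ℝ) =
      ∑ i : Fin (N + 1), (if Torus.coarseCell r (z i).1 = k then (1 : ℝ) else 0) := by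
  rw [Finset.card_filter]; push_cast; rfl

/-- The cell momentum (coordinate `j`) as a sum of guarded velocities. [folklore] -/
theorem sum_filter_vel_eq (r : ℝ) (z : Phase N) (k : Fin 3 → ℤ) (j : Fin 3) :
    (∑ i ∈ Finset.univ.filter (fun i => Torus.coarseCell r (z i).1 = k), (z i).2) j =
      ∑ i : Fin (N + 1), (if Torus.coarseCell r (z i).1 = k then (z i).2 j else 0) := by
  rw [WithLp.ofLp_sum, Finset.sum_apply, Finset.sum_filter]

/-- The cell energy as a sum of guarded squared speeds. [folklore] -/
theorem sum_filter_energy_eq (r : ℝ) (z : Phase N) (k : Fin 3 → ℤ) :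
    ∑ i ∈ Finset.univ.filter (fun i => Torus.coarseCell r (z i).1 = k), ‖(z i).2‖ ^ 2 =
      ∑ i : Fin (N + 1), (if Torus.coarseCell r (z i).1 = k then ‖(z i).2‖ ^ 2 else 0) := by
  rw [Finset.sum_filter]

/-- Measurability of the guarded indicator sums. [folklore] -/
theorem measurable_sum_ite_cellOf (r : ℝ) (k : Fin 3 → ℤ) {F : Phase N → Fin (N + 1) → ℝ}
    (hF : ∀ i, Measurable fun z => F z i) :
    Measurable fun z : Phase N => ∑ i : Fin (N + 1), (if Torus.coarseCell r (z i).1 = k then F z i else 0) := by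
  refine Finset.measurable_sum _ fun i _ => Measurable.ite ?_ (hF i) measurable_const
  exact (measurable_coarseCell_apply r i) (measurableSet_singleton k)

/-- **Level sets of the time-zero key are measurable.** [folklore] -/
theorem measurableSet_cellKey_eq (r w : ℝ) (β : (Fin 3 → ℤ) → ℕ × (Fin 3 → ℤ) × ℤ) :
    MeasurableSet {z : Phase N | cellKey r w z = β} := by
  have hrepr : {z : Phase N | cellKey r w z = β} = ⋂ k : Fin 3 → ℤ, {z | cellKey r w z k = β k} := by
    ext z; simp [funext_iff]
  rw [hrepr]
  refine MeasurableSet.iInter fun k => ?_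
  -- the three components of `cellKey r w z k`
  have hc : Measurable fun z : Phase N => ∑ i : Fin (N + 1), (if Torus.coarseCell r (z i).1 = k then (1 : ℝ) else 0) :=
    measurable_sum_ite_cellOf r k fun _ => measurable_const
  have hp : ∀ j : Fin 3, Measurable fun z : Phase N =>
      ⌊(∑ i : Fin (N + 1), (if Torus.coarseCell r (z i).1 = k then (z i).2 j else 0)) / w⌋ := fun j =>
    Int.measurable_floor.comp ((measurable_sum_ite_cellOf r k fun i =>
      (measurable_pi_apply j).comp ((WithLp.measurable_ofLp 2 (Fin 3 → ℝ)).comp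
        (measurable_pi_apply i).snd)).div_const w)
  have he : Measurable fun z : Phase N =>
      ⌊(∑ i : Fin (N + 1), (if Torus.coarseCell r (z i).1 = k then ‖(z i).2‖ ^ 2 else 0)) / w⌋ :=
    Int.measurable_floor.comp ((measurable_sum_ite_cellOf r k fun i =>
      ((measurable_pi_apply i).snd.norm.pow_const 2)).div_const w)
  have hset : {z : Phase N | cellKey r w z k = β k} =
      {z | (∑ i : Fin (N + 1), (if Torus.coarseCell r (z i).1 = k then (1 : ℝ) else 0)) = ((β k).1 : ℝ)} ∩
      ((⋂ j : Fin 3, {z | ⌊(∑ i : Fin (N + 1), (if Torus.coarseCell r (z i).1 = k then (z i).2 j else 0)) / w⌋ = (β k).2.1 j}) ∩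
        {z | ⌊(∑ i : Fin (N + 1), (if Torus.coarseCell r (z i).1 = k then ‖(z i).2‖ ^ 2 else 0)) / w⌋ = (β k).2.2}) := by
    ext z
    simp only [mem_setOf_eq, mem_inter_iff, mem_iInter]
    rw [← card_filter_cellOf_eq, ← sum_filter_energy_eq]
    simp_rw [← sum_filter_vel_eq]
    constructor
    · intro hz
      have h1 := congrArg Prod.fst hz
      have h2 := congrArg (fun q => q.2.1) hz
      have h3 := congrArg (fun q => q.2.2) hz
      simp only [cellKey] at h1 h2 h3
      refine ⟨by exact_mod_cast h1, fun j => ?_, h3⟩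
      exact congrFun h2 j
    · rintro ⟨h1, h2, h3⟩
      unfold cellKey
      ext
      · exact_mod_cast h1
      · exact h2 _
      · exact h3
  rw [hset]
  refine (measurableSet_eq_fun hc measurable_const).inter ((MeasurableSet.iInter fun j => ?_).inter ?_)
  · exact measurableSet_eq_fun (hp j) measurable_const
  · exact measurableSet_eq_fun he measurable_const

/-! ## Energy slack on a level set -/

/-- The kinetic energy is the sum of the cell energies over the occupied cells. [folklore] -/
theorem kinEnergy_eq_sum_cells (r : ℝ) (z : Phase N) :
    kinEnergy z = ∑ k ∈ Finset.univ.image (fun i => Torus.coarseCell r (z i).1),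
      ∑ i ∈ Finset.univ.filter (fun i => Torus.coarseCell r (z i).1 = k), ‖(z i).2‖ ^ 2 := by
  unfold kinEnergy
  rw [← Finset.sum_fiberwise_of_maps_to (g := fun i => Torus.coarseCell r (z i).1) (s := Finset.univ)
    (t := Finset.univ.image (fun i => Torus.coarseCell r (z i).1)) (fun i hi => Finset.mem_image_of_mem _ hi)]

/-- Same key ⇒ same occupied cells. [folklore] -/
theorem image_cellOf_eq_of_cellKey_eq {r w : ℝ} {z z' : Phase N} (h : cellKey r w z = cellKey r w z') :
    Finset.univ.image (fun i => Torus.coarseCell r (z i).1) = Finset.univ.image (fun i => Torus.coarseCell r (z' i).1) := by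
  -- a cell is occupied iff its count is positive, and counts agree
  have hcount : ∀ k, (Finset.univ.filter fun i => Torus.coarseCell r (z i).1 = k).card =
      (Finset.univ.filter fun i => Torus.coarseCell r (z' i).1 = k).card := fun k => by
    have := congrArg Prod.fst (congrFun h k)
    simpa [cellKey] using this
  ext k
  simp only [Finset.mem_image, Finset.mem_univ, true_and]
  have hk : (∃ i, Torus.coarseCell r (z i).1 = k) ↔ (Finset.univ.filter fun i => Torus.coarseCell r (z i).1 = k).Nonempty := by
    simp [Finset.filter_nonempty_iff]
  have hk' : (∃ i, Torus.coarseCell r (z' i).1 = k) ↔ (Finset.univ.filter fun i => Torus.coarseCell r (z' i).1 = k).Nonempty := by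
    simp [Finset.filter_nonempty_iff]
  rw [hk, hk', ← Finset.card_pos, ← Finset.card_pos, hcount]

/-- **Energy slack on a level set**: two configurations with the same key (bin width `w > 0`) have kinetic
energies within `(N+1) · w`. [folklore] -/
theorem abs_kinEnergy_sub_le_of_cellKey_eq {r w : ℝ} (hw : 0 < w) {z z' : Phase N}
    (h : cellKey r w z = cellKey r w z') : |kinEnergy z - kinEnergy z'| ≤ ((N : ℝ) + 1) * w := by
  rw [kinEnergy_eq_sum_cells r z, kinEnergy_eq_sum_cells r z', ← image_cellOf_eq_of_cellKey_eq h,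
    ← Finset.sum_sub_distrib]
  refine (Finset.abs_sum_le_sum_abs _ _).trans ?_
  have hcell : ∀ k, |∑ i ∈ Finset.univ.filter (fun i => Torus.coarseCell r (z i).1 = k), ‖(z i).2‖ ^ 2 -
      ∑ i ∈ Finset.univ.filter (fun i => Torus.coarseCell r (z' i).1 = k), ‖(z' i).2‖ ^ 2| ≤ w := fun k => by
    have := congrArg (fun q => q.2.2) (congrFun h k)
    simp only [cellKey] at this
    -- same bin ⇒ less than one bin width apart (Mathlib `Int.abs_sub_lt_one_of_floor_eq_floor`)
    have hlt := Int.abs_sub_lt_one_of_floor_eq_floor this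
    rw [← sub_div, abs_div, abs_of_pos hw, div_lt_one hw] at hlt
    exact hlt.le
  calc ∑ k ∈ Finset.univ.image (fun i => Torus.coarseCell r (z i).1), |∑ i ∈ Finset.univ.filter (fun i => Torus.coarseCell r (z i).1 = k),
          ‖(z i).2‖ ^ 2 - ∑ i ∈ Finset.univ.filter (fun i => Torus.coarseCell r (z' i).1 = k), ‖(z' i).2‖ ^ 2|
      ≤ ∑ _k ∈ Finset.univ.image (fun i => Torus.coarseCell r (z i).1), w := Finset.sum_le_sum fun k _ => hcell k
    _ = (Finset.univ.image (fun i => Torus.coarseCell r (z i).1)).card * w := by rw [Finset.sum_const, nsmul_eq_mul]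
    _ ≤ ((N : ℝ) + 1) * w := by
        gcongr
        have := Finset.card_image_le (s := Finset.univ) (f := fun i => Torus.coarseCell r (z i).1)
        simp only [Finset.card_univ, Fintype.card_fin] at this
        exact_mod_cast this

/-- **A level set met by a configuration of energy `≤ K(N+1)` lies inside `{KE ≤ (K + w)(N+1)}`.** [folklore] -/
theorem kinEnergy_le_of_cellKey_eq {r w K : ℝ} (hw : 0 < w) {z z₀ : Phase N}
    (h : cellKey r w z = cellKey r w z₀) (hz₀ : kinEnergy z₀ ≤ K * ((N : ℝ) + 1)) :
    kinEnergy z ≤ (K + w) * ((N : ℝ) + 1) := by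
  have := abs_kinEnergy_sub_le_of_cellKey_eq hw h
  rw [abs_sub_le_iff] at this
  nlinarith [this.1]

/-! ## The level set through a configuration, at the line's mesh -/

/-- The level set of the time-zero key (mesh and width `rs N`) through `z₀`. [folklore] -/
def keyLevel (N : ℕ) (z₀ : Phase N) : Set (Phase N) := {z | cellKey (rs N) (rs N) z = cellKey (rs N) (rs N) z₀}

/-- Unfolding lemma. [folklore] -/
theorem mem_keyLevel {z₀ z : Phase N} : z ∈ keyLevel N z₀ ↔ cellKey (rs N) (rs N) z = cellKey (rs N) (rs N) z₀ :=
  Iff.rfl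

/-- Level sets through configurations are measurable. [folklore] -/
theorem measurableSet_keyLevel (z₀ : Phase N) : MeasurableSet (keyLevel N z₀) := measurableSet_cellKey_eq _ _ _

/-- **Registered sub-goal `transferKey` of the glue (T-c3)**: level sets of the time-zero key are measurable. [folklore] -/
theorem transferKey : ∀ (N : ℕ) (r w : ℝ) (β : (Fin 3 → ℤ) → ℕ × (Fin 3 → ℤ) × ℤ),
    MeasurableSet {z : Phase N | cellKey r w z = β} :=
  fun _ r w β => measurableSet_cellKey_eq r w β

end Summit.AtomisticToContinuum.HydrodynamicLimit.Theorems.KickFairRelEquilibriumMesoLine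

end
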